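import Mathlib
import Literature.NumberTheory.LFunctions.Zhang2022.SkeletonPartThree
import Literature.NumberTheory.LFunctions.Zhang2022.TypedAppendixB
import Literature.NumberTheory.LFunctions.Zhang2022.SkeletonAlpha1
import Literature.NumberTheory.LFunctions.Zhang2022.AppendixB
import Literature.NumberTheory.LFunctions.Zhang2022.AppendixBLemma151Residues
import Literature.NumberTheory.LFunctions.Zhang2022.AppendixBLemma151Cauchy
import Literature.NumberTheory.LFunctions.Zhang2022.AppendixBLemma151Circles
import Literature.NumberTheory.LFunctions.Zhang2022.AppendixBLemma151Mu3Circles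

/-!
# Zhang (2022) Appendix B, proof of Lemma 15.1, `μ = 3`: the VALUE of the residue at the double pole
# `β₆` — "`= (1 − 2j/3 + j/(1.1205πi)) exp{0.747πi} + O(α₁)`" — and `StepB_mu3R` from the two
# remaining `μ = 3` inputs (Perron identity, line → circle)

Topic `Literature/NumberTheory/LFunctions/Zhang2022` (Landau–Siegel audit tree; verdict-neutral).
Y. Zhang, *Discrete mean estimates and the Landau–Siegel zero*, arXiv:2211.02515v1 (2022)
[Zhang2022LandauSiegel] — **an unrefereed manuscript under adjudication; nothing in this file asserts
any claim of the manuscript beyond the displayed evaluations it PROVES.** ZHANG-L discharge lane (WP15,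
App. B part B3 under leaf `Typed.Section15C.Eq15_22` / Lemma 15.1 χR), DAG node `Z22:§B.u011`
[Z22 p.107, tex L5304–5310]: the `μ = 3` twin ("with `β₆` and `P₃` in place of `β₇` and `P₂`") of
"the residue at `s = β₇` is, by the Cauchy integral formula, … `= (1 − 2j/5 + 8j/(25πi))exp{5πi/4} + O(α₁)`",
in the reading of record `α₁ = α log T` (`Skeleton.alpha1`).

PROVED here (theorem-only; the `μ = 3` integrand is written inline as
`zetaRatio c′ D j s * kerB (P3 D) (beta6 D) l₁ s = ζ(1+s)/ζ(1+s−β_j)·(P₃/l₁)ˢ/((log P₃)(s−β₆)²)`):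

* `appBResBeta_main_mu3` — at the main values (`β_j⁰ = jiα`, `β₆ = 3iα/2`, `log P₃ = 0.498·log P`,
  `α log P = π`) the model residue `AppendixB.appBResBeta` is EXACTLY `(1 − 2j/3 + j/(1.1205πi))e^{0.747πi}`
  (`1.1205 = (3/2)²·0.498`, `0.747 = (3/2)·0.498`);
* `circleIntegral_intB3_beta6_sub_main_le` — for `D` large, `j ∈ {1,2,3}`, `1 ≤ l₁ < T`:
  `‖(2πi)⁻¹∮_{|s−β₆|=α} intB3 − (1 − 2j/3 + j/(1.1205πi))e^{0.747πi}‖ ≤ C·α₁`. Route: by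
  `Skeleton.circleIntegrals_intB3` the circle integral is `−G(β₆)/β₆² + G′(β₆)/β₆` with
  `G(s) = ζ₁(1+s)(s−β_j)ζ₁(1+s−β_j)⁻¹(P₃/l₁)ˢ/log P₃`; writing `G = ρ·M`, `M(s) = (s−β_j)e^{s log P₃}/log P₃`
  (whose residue combination is `appBResBeta β_j β₆ (log P₃)` on the nose) and
  `ρ(s) = ζ₁(1+s)ζ₁(1+s−β_j)⁻¹ l₁^{−s}`, the error is `(ρ(β₆) − 1)·O(1) + M(β₆)ρ′(β₆)/β₆` with
  `ζ₁(1+z) = 1 + O(|z|)`, `ζ₁′ = O(1)` near `1` (`zeta1_near_one`), `|l₁^{−β₆} − 1| ≤ |β₆| log l₁ ≤ (3/2)α𝓛^{1.1}`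
  (`l₁ < T = e^{𝓛^{1.1}}`) and `log l₁/log P₃ ≤ 𝓛^{1.1}/(0.498𝓛⁹)`; finally `β_j = β_j⁰(1 + O(c′α𝓛))`
  moves `appBResBeta` by `O(α𝓛)`; every piece is `≤ C(K, c′)·α₁`;
* `stepB_mu3R_of_perron_shift` — **`Typed.AppendixB.StepB_mu3R c′` from the `μ = 3` Perron identity and
  the `μ = 3` line-to-circle bound alone** (the value above discharges `h11` of
  `Skeleton.stepB_mu3R_of`; the split and the residue at `0` were discharged in `…Mu3Circles`).

WHAT THIS IS NOT: the `μ = 3` Perron identity, the `μ = 3` contour shift (line → circle), Lemma 15.1,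
or any claim about Theorems 1–2 / Landau–Siegel zeros.

## References

* Y. Zhang, arXiv:2211.02515v1 (2022), App. B p. 107 (proof of Lemma 15.1, `μ = 2, 3`); Lemma 15.1
  p. 80 (`e_{3j}`); §2 (2.10), (2.13), (2.21), (2.22). [cite: Zhang2022LandauSiegel, App. B p.107]
-/

noncomputable section

open Complex Real Metric Set Filter Topology

namespace Literature.NumberTheory.LFunctions.Zhang2022.Skeleton

open Typed.AppendixB (zetaRatio kerB vline vkSum)

section MainValue

variable {α Λ : ℝ}

/-- The `μ = 3` residue at the double pole at its main values: with `b = β_j⁰ = jiα`, `β = β₆ = 3iα/2`,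
`L = 0.498·Λ` and `αΛ = π`, `appBResBeta b β L = (1 − 2j/3 + j/(1.1205πi))·e^{0.747πi}`
(`b/β = 2j/3`, `βL = 0.747πi`, `b/(Lβ²) = j/(1.1205πi)`). [cite: Zhang2022LandauSiegel, App. B p.107] -/
theorem appBResBeta_main_mu3 (hα : α ≠ 0) (h : α * Λ = π) (j : ℕ) :
    appBResBeta (betaMain j α) (betaMain (3/2) α) ((0.498 : ℂ) * Λ)
      = (1 - 2 * (j : ℂ) / 3 + (j : ℂ) / (1.1205 * π * I)) * cexp (0.747 * π * I) := by
  have hπ : (π : ℂ) = (α : ℂ) * Λ := by rw [← Complex.ofReal_mul, h]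
  have hα' : (α : ℂ) ≠ 0 := by exact_mod_cast hα
  have hΛ : Λ ≠ 0 := by intro hz; rw [hz, mul_zero] at h; exact Real.pi_ne_zero h.symm
  have hΛ' : (Λ : ℂ) ≠ 0 := by exact_mod_cast hΛ
  have hI : I ≠ 0 := I_ne_zero
  have hE : cexp (betaMain (3/2) α * ((0.498 : ℂ) * Λ)) = cexp (0.747 * π * I) := by
    congr 1; unfold betaMain; rw [hπ]; push_cast; ring
  unfold appBResBeta
  rw [hE]
  unfold betaMain
  rw [hπ]
  generalize cexp (0.747 * ((α : ℂ) * Λ) * I) = w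
  push_cast
  field_simp
  ring

end MainValue

section Value

variable (c' : ℝ)

/-- `L₀ ≤ log D` once `D ≥ ⌈exp L₀⌉₊`. [folklore] -/
private theorem le_ell_of_ceil_exp_le₄ {L₀ : ℝ} {D : ℕ} (hD : ⌈Real.exp L₀⌉₊ ≤ D) : L₀ ≤ ell D := by
  have h : Real.exp L₀ ≤ D := le_trans (Nat.le_ceil _) (by exact_mod_cast hD)
  exact (Real.le_log_iff_exp_le (lt_of_lt_of_le (Real.exp_pos _) h)).mpr h

/-- For a purely imaginary exponent the exponential has norm one: `‖e^{u·L}‖ = 1` for `u = (3a/2)i`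
and real `L`. [folklore] -/
private theorem norm_exp_imag (y L : ℝ) : ‖cexp ((((y : ℝ) : ℂ) * I) * (L : ℂ))‖ = 1 := by
  rw [show (((y : ℝ) : ℂ) * I) * (L : ℂ) = ((y * L : ℝ) : ℂ) * I by push_cast; ring]
  exact Complex.norm_exp_ofReal_mul_I _

/-- `‖e^{−u·t} − 1‖ ≤ |y|·t` for `u = y·i` purely imaginary and `t` real. [folklore] -/
private theorem norm_exp_imag_sub_one_le (y t : ℝ) :
    ‖cexp (-((((y : ℝ) : ℂ) * I) * (t : ℂ))) - 1‖ ≤ |y| * |t| := by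
  rw [show -((((y : ℝ) : ℂ) * I) * (t : ℂ)) = I * ((-(y * t) : ℝ) : ℂ) by push_cast; ring]
  calc ‖cexp (I * ((-(y * t) : ℝ) : ℂ)) - 1‖ ≤ ‖(-(y * t) : ℝ)‖ := Real.norm_exp_I_mul_ofReal_sub_one_le
    _ = |y| * |t| := by rw [Real.norm_eq_abs, abs_neg, abs_mul]

set_option maxHeartbeats 400000 in
/-- **The value of the `β₆`-residue, `μ = 3`** (App. B p. 107, twin of `Z22:§B.u011` second line, reading
`α₁ = α log T`): for `D` large, `j ∈ {1,2,3}`, `1 ≤ l₁ < T`,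
`‖(2πi)⁻¹∮_{|s−β₆|=α} ζ(1+s)/ζ(1+s−β_j)·(P₃/l₁)ˢ/((log P₃)(s−β₆)²) ds − (1 − 2j/3 + j/(1.1205πi))e^{0.747πi}‖
≤ C·α₁`. (The hypothesis `l₁ ∈ 𝒩(𝔮)` of the typed node is not needed and is carried as `_`.)
[cite: Zhang2022LandauSiegel, App. B p.107] -/
theorem circleIntegral_intB3_beta6_sub_main_le : ∃ C : ℝ, ForAllLarge fun D _ _ =>
    ∀ j ∈ ({1, 2, 3} : Finset ℕ), ∀ l₁ : ℕ, 1 ≤ l₁ → l₁ ∈ nset (frakq D) → (l₁ : ℝ) < bigT D →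
      ‖(2 * π * I)⁻¹ * (∮ s in C(beta6 D, alpha D), zetaRatio c' D j s * kerB (P3 D) (beta6 D) l₁ s) -
          (1 - 2 * (j : ℂ) / 3 + (j : ℂ) / (1.1205 * π * I)) * cexp (0.747 * π * I)‖ ≤
        C * alpha1 D := by
  obtain ⟨δ, hδ, K, hK, hζ⟩ := zeta1_near_one
  obtain ⟨D₀, hcirc⟩ := circleIntegrals_intB3 c'
  refine ⟨200 * K + 40 + 15 * |c'|,
    max D₀ (max 8 ⌈Real.exp (max (max 2 (60 * |c'| * π)) (max (10 * π / δ) (8 * K * π)))⌉₊),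
    fun D _ χ hD hq hp j hj l₁ hl₁ _ hT => ?_⟩
  obtain ⟨-, -, h6⟩ := hcirc D (le_trans (le_max_left _ _) hD) j hj l₁ hl₁
  obtain ⟨hℓ2, hc, hδα, hKα, hα0, -, -⟩ := large_package c' hδ hK
    (le_ell_of_ceil_exp_le₄ (le_trans (le_max_right _ _) (le_trans (le_max_right _ _) hD)))
  obtain ⟨-, hb4, -, -, -⟩ := betaJ_size c' hℓ2 hc hj
  obtain ⟨hb6, hn6⟩ := beta6_size c' hℓ2 hc hj
  rw [h6]
  ------------------------------------------------------------------
  -- Real parameters `ℓ, a, L, t` (abbreviated, then made opaque: all later steps use only the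
  -- recorded facts, so that no tactic ever unfolds `alpha`, `ell`, `P3`, … by definitional unfolding)
  ------------------------------------------------------------------
  have hℓ0 : 0 < ell D := by linarith
  have hℓ1 : 1 ≤ ell D := by linarith
  have hπ3 : (3 : ℝ) < π := Real.pi_gt_three
  set Lc : ℂ := (Real.log (P3 D) : ℂ) with hLc
  set x : ℂ := ((P3 D / l₁ : ℝ) : ℂ) with hxdef
  set b := betaJ c' D j with hb
  set β := beta6 D with hβdef
  set ℓ : ℝ := ell D with hℓ
  set a : ℝ := alpha D with ha
  have h9 : a * ℓ ^ 9 = π := by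
    rw [ha, alpha, bigP, Real.log_exp, ← hℓ, div_mul_cancel₀ _ (pow_ne_zero _ hℓ0.ne')]
  have hα1 : alpha1 D = a * ℓ ^ (1.1 : ℝ) := by rw [alpha1, log_bigT, ← hℓ, ← ha]
  set L : ℝ := Real.log (P3 D) with hL
  have hLeq : L = 0.498 * ℓ ^ 9 := by rw [hL, log_P3]
  have hLcL : Lc = (L : ℂ) := by rw [hLc, hL]
  have hP3 : 0 < P3 D := by rw [P3]; exact Real.rpow_pos_of_pos (Real.exp_pos _) _
  have hl₁pos : (0 : ℝ) < l₁ := by exact_mod_cast hl₁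
  have hx : 0 < P3 D / l₁ := div_pos hP3 hl₁pos
  have hx0 : x ≠ 0 := by rw [hxdef]; exact_mod_cast hx.ne'
  set t : ℝ := Real.log l₁ with ht
  have hlogx : Complex.log x = ((L - t : ℝ) : ℂ) := by
    rw [hxdef, ← Complex.ofReal_log hx.le, Real.log_div hP3.ne' hl₁pos.ne']
  have ht0 : 0 ≤ t := Real.log_nonneg (by exact_mod_cast hl₁)
  have htT : t ≤ ℓ ^ (1.1 : ℝ) := by
    have h1 : t < Real.log (bigT D) := Real.log_lt_log hl₁pos hT
    rw [log_bigT, ← hℓ] at h1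
    exact h1.le
  -- `β = (3a/2)·i`, `b = ja(1+e)·i` with `|e| ≤ 5|c′|·aℓ`
  have hβreal : β = (((3 / 2 * a : ℝ)) : ℂ) * I := by rw [hβdef, beta6, ← ha]; push_cast; ring
  obtain ⟨κ, hκ, hbκ⟩ := betaJ_eq_of_mem c' D hj
  rw [← hb, ← ha, ← hℓ] at hbκ
  set e : ℝ := κ * c' * a * ℓ with he
  have habs_e : |e| ≤ 5 * |c'| * (a * ℓ) := by
    rw [he, show κ * c' * a * ℓ = (κ * c') * (a * ℓ) by ring, abs_mul, abs_mul,
      abs_of_pos (mul_pos hα0 hℓ0)]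
    exact mul_le_mul_of_nonneg_right (mul_le_mul_of_nonneg_right hκ (abs_nonneg c'))
      (mul_pos hα0 hℓ0).le
  -- make the real abbreviations opaque
  clear_value e t L a ℓ
  -- derived real facts
  have ha_nn : 0 ≤ a := hα0.le
  have ha_ne : a ≠ 0 := hα0.ne'
  have ha32 : 0 < 3 / 2 * a := by linarith
  have haL : a * L = 0.498 * π := by rw [hLeq, ← h9]; ring
  have hL0 : 0 < L := by rw [hLeq]; positivity
  have hL_ne : L ≠ 0 := hL0.ne'
  have hLc0 : Lc ≠ 0 := by rw [hLcL]; exact_mod_cast hL_ne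
  have h11 : (1 : ℝ) ≤ ℓ ^ (1.1 : ℝ) := Real.one_le_rpow hℓ1 (by norm_num)
  have haα1 : a ≤ alpha1 D := by rw [hα1]; nlinarith
  have hatα1 : a * t ≤ alpha1 D := by rw [hα1]; exact mul_le_mul_of_nonneg_left htT ha_nn
  have hα1nn : 0 ≤ alpha1 D := le_trans ha_nn haα1
  have haℓα1 : a * ℓ ≤ alpha1 D := by
    rw [hα1]
    have h1l : ℓ ≤ ℓ ^ (1.1 : ℝ) := by
      calc ℓ = ℓ ^ (1 : ℝ) := (Real.rpow_one ℓ).symm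
        _ ≤ ℓ ^ (1.1 : ℝ) := Real.rpow_le_rpow_of_exponent_le hℓ1 (by norm_num)
    exact mul_le_mul_of_nonneg_left h1l ha_nn
  have hKa : K * a ≤ 1 / 8 := by linarith
  have hKa_nn : 0 ≤ K * a := mul_nonneg hK ha_nn
  -- scalar inequalities used at the end
  have hnumA : 4 * a ≤ 6 / 5 * (9 / 4 * (0.498 * π) * a) := by
    have := mul_le_mul_of_nonneg_right hπ3.le ha_nn
    linarith
  have hnumC : (2 : ℝ) / 3 + 4 / (9 * 0.498 * π) ≤ 1 := by
    have : 4 / (9 * 0.498 * π) ≤ 1 / 3 := by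
      rw [div_le_div_iff₀ (by positivity) (by norm_num)]; linarith
    linarith
  have hnumR : 100 * (K * ℓ ^ (1.1 : ℝ)) + 22 * ℓ ^ (1.1 : ℝ) ≤
      (45 * K + 10) * (0.747 * (π * ℓ ^ (1.1 : ℝ))) := by
    have hKℓ : 0 ≤ K * ℓ ^ (1.1 : ℝ) := mul_nonneg hK (le_trans zero_le_one h11)
    have p1 : 3 * (K * ℓ ^ (1.1 : ℝ)) ≤ π * (K * ℓ ^ (1.1 : ℝ)) :=
      mul_le_mul_of_nonneg_right hπ3.le hKℓ
    have p2 : 3 * ℓ ^ (1.1 : ℝ) ≤ π * ℓ ^ (1.1 : ℝ) :=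
      mul_le_mul_of_nonneg_right hπ3.le (le_trans zero_le_one h11)
    linarith
  -- complex size facts
  have hβ0 : β ≠ 0 := by intro h; rw [h, norm_zero] at hn6; linarith
  have hβb : β ≠ b := by intro h; rw [h, sub_self, norm_zero] at hb6; linarith
  have hβb5 : ‖β - b‖ ≤ 11 / 2 * a := by
    calc ‖β - b‖ ≤ ‖β‖ + ‖b‖ := norm_sub_le _ _
      _ ≤ 3 / 2 * a + 4 * a := by rw [hn6]; exact add_le_add le_rfl hb4
      _ = 11 / 2 * a := by ring
  -- the `ζ₁`-data at `β` and `β − b`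
  have hβδ : ‖β‖ ≤ δ := by rw [hn6]; linarith
  have hβbδ : ‖β - b‖ ≤ δ := by linarith
  obtain ⟨hz1, hz1', -⟩ := hζ β hβδ
  obtain ⟨hz2, hz2', hz2ne⟩ := hζ (β - b) hβbδ
  have e12 : (1 : ℂ) + (β - b) = 1 + β - b := by ring
  rw [e12] at hz2 hz2' hz2ne
  ------------------------------------------------------------------
  -- The function `G` and its derivative at `β`
  ------------------------------------------------------------------
  set G : ℂ → ℂ := fun s =>
    riemannZeta₁ (1 + s) * (s - b) * (riemannZeta₁ (1 + s - b))⁻¹ * x ^ s / Lc with hG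
  have hd1 : HasDerivAt (fun s : ℂ => riemannZeta₁ (1 + s)) (deriv riemannZeta₁ (1 + β)) β := by
    have hA : HasDerivAt riemannZeta₁ (deriv riemannZeta₁ (1 + β)) (1 + β) :=
      (differentiable_riemannZeta₁ _).hasDerivAt
    exact HasDerivAt.comp_const_add (f := riemannZeta₁) 1 β hA
  have hd2 : HasDerivAt (fun s : ℂ => riemannZeta₁ (1 + s - b))
      (deriv riemannZeta₁ (1 + β - b)) β := by
    -- via the translation lemmas (explicit points: no higher-order unification against `β`, `b`)
    have hA : HasDerivAt riemannZeta₁ (deriv riemannZeta₁ (1 + β - b)) (1 + β - b) :=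
      (differentiable_riemannZeta₁ _).hasDerivAt
    have h1 := HasDerivAt.comp_sub_const (f := riemannZeta₁) (1 + β) b hA
    exact HasDerivAt.comp_const_add (f := fun y : ℂ => riemannZeta₁ (y - b)) 1 β h1
  have hd3 : HasDerivAt (fun s : ℂ => (riemannZeta₁ (1 + s - b))⁻¹)
      (-deriv riemannZeta₁ (1 + β - b) / riemannZeta₁ (1 + β - b) ^ 2) β :=
    hd2.fun_inv hz2ne
  have hd4 : HasDerivAt (fun s : ℂ => s - b) 1 β := (hasDerivAt_id β).sub_const b
  have hd5 : HasDerivAt (fun s : ℂ => x ^ s) (x ^ β * Complex.log x) β := by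
    simpa using (hasDerivAt_id β).const_cpow (Or.inl hx0)
  have hGd : HasDerivAt G
      ((((deriv riemannZeta₁ (1 + β) * (β - b) + riemannZeta₁ (1 + β) * 1) *
            (riemannZeta₁ (1 + β - b))⁻¹ +
          riemannZeta₁ (1 + β) * (β - b) *
            (-deriv riemannZeta₁ (1 + β - b) / riemannZeta₁ (1 + β - b) ^ 2)) * x ^ β +
        riemannZeta₁ (1 + β) * (β - b) * (riemannZeta₁ (1 + β - b))⁻¹ * (x ^ β * Complex.log x)) /
        Lc) β := by
    have h := (((hd1.mul hd4).mul hd3).mul hd5).div_const Lc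
    simpa only [Pi.mul_apply] using h
  have hGβ : G β = riemannZeta₁ (1 + β) * (β - b) * (riemannZeta₁ (1 + β - b))⁻¹ * x ^ β / Lc :=
    rfl
  rw [hGd.deriv, hGβ, hlogx]
  ------------------------------------------------------------------
  -- Abbreviations for the complex data (made opaque), and their sizes
  ------------------------------------------------------------------
  set z₁ : ℂ := riemannZeta₁ (1 + β) with hz₁
  set z₁' : ℂ := deriv riemannZeta₁ (1 + β) with hz₁'
  set z₂ : ℂ := riemannZeta₁ (1 + β - b) with hz₂
  set z₂' : ℂ := deriv riemannZeta₁ (1 + β - b) with hz₂'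
  set X : ℂ := x ^ β with hXdef
  have hXexp : X = cexp (β * ((L - t : ℝ) : ℂ)) := by
    rw [hXdef, Complex.cpow_def_of_ne_zero hx0, hlogx, mul_comm]
  clear_value z₁ z₁' z₂ z₂' X
  clear hd1 hd2 hd3 hd4 hd5 hGd
  set E : ℂ := cexp (β * Lc) with hEdef
  clear_value E
  have hXE : X = E * cexp (-(β * (t : ℂ))) := by
    rw [hXexp, hEdef, hLcL, ← Complex.exp_add]; congr 1; push_cast; ring
  have hEn : ‖E‖ = 1 := by rw [hEdef, hLcL, hβreal]; exact norm_exp_imag _ _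
  have hXn : ‖X‖ = 1 := by rw [hXexp, hβreal]; exact norm_exp_imag _ _
  have hdX : ‖X - E‖ ≤ 3 / 2 * a * t := by
    have : X - E = E * (cexp (-(β * (t : ℂ))) - 1) := by rw [hXE]; ring
    rw [this, norm_mul, hEn, one_mul, hβreal]
    calc _ ≤ |3 / 2 * a| * |t| := norm_exp_imag_sub_one_le _ _
      _ = 3 / 2 * a * t := by rw [abs_of_pos ha32, abs_of_nonneg ht0]
  -- norm bounds on the `ζ₁`-data (`Ka ≤ 1/8`)
  have hz2c : z₂ ≠ 0 := hz2ne
  have hu1 : ‖z₁ - 1‖ ≤ 3 / 2 * (K * a) := by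
    calc ‖z₁ - 1‖ ≤ K * ‖β‖ := hz1
      _ = 3 / 2 * (K * a) := by rw [hn6]; ring
  have hz1n : ‖z₁‖ ≤ 6 / 5 := by
    have h1 := norm_le_norm_add_norm_sub' z₁ 1
    rw [norm_one] at h1
    have h2 : ‖z₁ - 1‖ ≤ 3 / 16 := by linarith [hu1, hKa]
    linarith
  have hz2sub : ‖z₂ - 1‖ ≤ 11 / 2 * (K * a) := by
    calc ‖z₂ - 1‖ ≤ K * ‖β - b‖ := hz2
      _ ≤ K * (11 / 2 * a) := mul_le_mul_of_nonneg_left hβb5 hK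
      _ = 11 / 2 * (K * a) := by ring
  have hz2low : 5 / 16 ≤ ‖z₂‖ := by
    have h := norm_sub_norm_le (1 : ℂ) z₂
    rw [norm_one, norm_sub_rev] at h
    linarith [hz2sub, hKa]
  have hz2inv : ‖z₂⁻¹‖ ≤ 16 / 5 := by
    rw [norm_inv]; exact inv_le_of_inv_le₀ (by norm_num) (by rw [inv_div]; exact hz2low)
  have hw2 : ‖z₂⁻¹ - 1‖ ≤ 18 * (K * a) := by
    have : z₂⁻¹ - 1 = z₂⁻¹ * (1 - z₂) := by rw [mul_sub, mul_one, inv_mul_cancel₀ hz2c]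
    rw [this, norm_mul, norm_sub_rev]
    calc ‖z₂⁻¹‖ * ‖z₂ - 1‖ ≤ 16 / 5 * (11 / 2 * (K * a)) :=
          mul_le_mul hz2inv hz2sub (norm_nonneg _) (by norm_num)
      _ = 88 / 5 * (K * a) := by ring
      _ ≤ 18 * (K * a) := mul_le_mul_of_nonneg_right (by norm_num) hKa_nn
  ------------------------------------------------------------------
  -- The algebraic decomposition `V − T₁ = (P − E)·A + R`, `T₁ = appBResBeta b β L = E·A`
  ------------------------------------------------------------------
  set P : ℂ := z₁ * z₂⁻¹ * X with hP
  set A : ℂ := 1 - b / β + b / (Lc * β ^ 2) with hA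
  set R : ℂ := (z₁' * (β - b) * z₂⁻¹ * X - (β - b) * z₂' * z₂⁻¹ * P - (β - b) * P * (t : ℂ)) /
    (β * Lc) with hR
  set T₀ : ℂ := (1 - 2 * (j : ℂ) / 3 + (j : ℂ) / (1.1205 * π * I)) * cexp (0.747 * π * I) with hT₀
  have hLt : ((L - t : ℝ) : ℂ) = Lc - (t : ℂ) := by rw [hLcL]; push_cast; ring
  have key : -(z₁ * (β - b) * z₂⁻¹ * X / Lc / β ^ 2) +
      (((z₁' * (β - b) + z₁ * 1) * z₂⁻¹ + z₁ * (β - b) * (-z₂' / z₂ ^ 2)) * X +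
          z₁ * (β - b) * z₂⁻¹ * (X * ((L - t : ℝ) : ℂ))) / Lc / β - E * A =
        (P - E) * A + R := by
    rw [hLt]
    simp only [hP, hA, hR]
    field_simp
    ring
  -- `T₁ − T₀`: the model residue at the exact `b = β_j` versus at the main value `b₀ = jiα`
  set b₀ : ℂ := betaMain j a with hb₀
  have hT₀eq : T₀ = appBResBeta b₀ β Lc := by
    have hΛ : Lc = (0.498 : ℂ) * ((ℓ ^ 9 : ℝ) : ℂ) := by rw [hLcL, hLeq]; push_cast; ring
    have hβm : β = betaMain (3/2) a := by rw [hβreal, betaMain]; push_cast; ring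
    rw [hT₀, hb₀, hβm, hΛ, appBResBeta_main_mu3 ha_ne h9 j]
  clear_value b₀
  have hb₀' : b₀ = ((j : ℚ) : ℂ) * I * (a : ℂ) := by rw [hb₀, betaMain]
  have hT₁T₀ : E * A - appBResBeta b₀ β Lc = (b - b₀) * (-1 / β + 1 / (Lc * β ^ 2)) * E := by
    simp only [hA, appBResBeta, ← hEdef]
    ring
  have hbb₀ : ‖b - b₀‖ = (j : ℝ) * a * |e| := by
    rw [hbκ, hb₀']
    have : (((j * a * (1 + e) : ℝ)) : ℂ) * I - ((j : ℚ) : ℂ) * I * (a : ℂ) =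
        (((j * a * e : ℝ)) : ℂ) * I := by push_cast; ring
    rw [this, norm_mul, Complex.norm_I, mul_one, Complex.norm_real, Real.norm_eq_abs, abs_mul,
      abs_mul, abs_of_nonneg (Nat.cast_nonneg j), abs_of_pos hα0]
  -- sizes
  have hj3 : (j : ℝ) ≤ 3 := by
    simp only [Finset.mem_insert, Finset.mem_singleton] at hj
    rcases hj with rfl | rfl | rfl <;> norm_num
  have hLcn : ‖Lc‖ = L := by rw [hLcL, Complex.norm_real, Real.norm_eq_abs, abs_of_pos hL0]
  -- (i) `‖A‖ ≤ 5`
  have hA5 : ‖A‖ ≤ 5 := by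
    have h1 : ‖b / β‖ ≤ 8 / 3 := by
      rw [norm_div, hn6, div_le_iff₀ ha32]
      calc ‖b‖ ≤ 4 * a := hb4
        _ = 8 / 3 * (3 / 2 * a) := by ring
    have h2 : ‖b / (Lc * β ^ 2)‖ ≤ 6 / 5 := by
      rw [norm_div, norm_mul, norm_pow, hLcn, hn6, div_le_iff₀ (mul_pos hL0 (pow_pos ha32 2))]
      have : 4 * a ≤ 6 / 5 * (L * (3 / 2 * a) ^ 2) := by
        have : L * (3 / 2 * a) ^ 2 = 9 / 4 * (a * L) * a := by ring
        rw [this, haL]; exact hnumA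
      exact hb4.trans this
    rw [hA]
    calc ‖1 - b / β + b / (Lc * β ^ 2)‖ ≤ ‖(1 : ℂ) - b / β‖ + ‖b / (Lc * β ^ 2)‖ := norm_add_le _ _
      _ ≤ (‖(1 : ℂ)‖ + ‖b / β‖) + ‖b / (Lc * β ^ 2)‖ := add_le_add (norm_sub_le _ _) le_rfl
      _ ≤ (1 + 8 / 3) + 6 / 5 := by rw [norm_one]; exact add_le_add (add_le_add le_rfl h1) h2
      _ ≤ 5 := by norm_num
  have hA_nn : 0 ≤ ‖A‖ := norm_nonneg _
  -- (ii) `‖P − E‖ ≤ 24Ka + (3/2)a t`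
  have hPn : ‖P‖ ≤ 4 := by
    rw [hP, norm_mul, norm_mul, hXn, mul_one]
    have := mul_le_mul hz1n hz2inv (norm_nonneg _) (by norm_num)
    exact this.trans (by norm_num)
  have hMn : ‖(z₁ - 1) * z₂⁻¹ + (z₂⁻¹ - 1)‖ ≤ 24 * (K * a) := by
    have p1 : ‖z₁ - 1‖ * ‖z₂⁻¹‖ ≤ 3 / 2 * (K * a) * (16 / 5) :=
      mul_le_mul hu1 hz2inv (norm_nonneg _) (mul_nonneg (by norm_num) hKa_nn)
    calc _ ≤ ‖(z₁ - 1) * z₂⁻¹‖ + ‖z₂⁻¹ - 1‖ := norm_add_le _ _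
      _ = ‖z₁ - 1‖ * ‖z₂⁻¹‖ + ‖z₂⁻¹ - 1‖ := by rw [norm_mul]
      _ ≤ 3 / 2 * (K * a) * (16 / 5) + 18 * (K * a) := add_le_add p1 hw2
      _ = 114 / 5 * (K * a) := by ring
      _ ≤ 24 * (K * a) := mul_le_mul_of_nonneg_right (by norm_num) hKa_nn
  have hPE : ‖P - E‖ ≤ 24 * (K * a) + 3 / 2 * a * t := by
    have : P - E = ((z₁ - 1) * z₂⁻¹ + (z₂⁻¹ - 1)) * X + (X - E) := by rw [hP]; ring
    rw [this]
    calc _ ≤ ‖((z₁ - 1) * z₂⁻¹ + (z₂⁻¹ - 1)) * X‖ + ‖X - E‖ := norm_add_le _ _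
      _ = ‖(z₁ - 1) * z₂⁻¹ + (z₂⁻¹ - 1)‖ * ‖X‖ + ‖X - E‖ := by rw [norm_mul]
      _ = ‖(z₁ - 1) * z₂⁻¹ + (z₂⁻¹ - 1)‖ + ‖X - E‖ := by rw [hXn, mul_one]
      _ ≤ 24 * (K * a) + 3 / 2 * a * t := add_le_add hMn hdX
  -- (iii) `‖R‖ ≤ (100K + 22t)/((3/2)L)`
  have hRn : ‖R‖ ≤ (100 * K + 22 * t) / (3 / 2 * L) := by
    rw [hR, norm_div, norm_mul, hn6, hLcn]
    rw [div_le_div_iff₀ (mul_pos ha32 hL0) (mul_pos (by norm_num : (0:ℝ) < 3 / 2) hL0)]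
    have e1 : ‖z₁' * (β - b) * z₂⁻¹ * X‖ ≤ K * (11 / 2 * a) * (16 / 5) := by
      have p1 : ‖z₁'‖ * ‖β - b‖ ≤ K * (11 / 2 * a) := mul_le_mul hz1' hβb5 (norm_nonneg _) hK
      have p2 : ‖z₁'‖ * ‖β - b‖ * ‖z₂⁻¹‖ ≤ K * (11 / 2 * a) * (16 / 5) :=
        mul_le_mul p1 hz2inv (norm_nonneg _) (mul_nonneg hK (mul_nonneg (by norm_num) ha_nn))
      calc ‖z₁' * (β - b) * z₂⁻¹ * X‖ = ‖z₁'‖ * ‖β - b‖ * ‖z₂⁻¹‖ * ‖X‖ := by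
            simp only [norm_mul]
        _ ≤ K * (11 / 2 * a) * (16 / 5) := by rw [hXn, mul_one]; exact p2
    have e2 : ‖(β - b) * z₂' * z₂⁻¹ * P‖ ≤ 11 / 2 * a * K * (16 / 5) * 4 := by
      have n1 : (0 : ℝ) ≤ 11 / 2 * a := mul_nonneg (by norm_num) ha_nn
      have n2 : (0 : ℝ) ≤ 11 / 2 * a * K := mul_nonneg n1 hK
      have n3 : (0 : ℝ) ≤ 11 / 2 * a * K * (16 / 5) := mul_nonneg n2 (by norm_num)
      have p1 : ‖β - b‖ * ‖z₂'‖ ≤ 11 / 2 * a * K := mul_le_mul hβb5 hz2' (norm_nonneg _) n1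
      have p2 : ‖β - b‖ * ‖z₂'‖ * ‖z₂⁻¹‖ ≤ 11 / 2 * a * K * (16 / 5) :=
        mul_le_mul p1 hz2inv (norm_nonneg _) n2
      have p3 : ‖β - b‖ * ‖z₂'‖ * ‖z₂⁻¹‖ * ‖P‖ ≤ 11 / 2 * a * K * (16 / 5) * 4 :=
        mul_le_mul p2 hPn (norm_nonneg _) n3
      calc ‖(β - b) * z₂' * z₂⁻¹ * P‖ = ‖β - b‖ * ‖z₂'‖ * ‖z₂⁻¹‖ * ‖P‖ := by simp only [norm_mul]
        _ ≤ _ := p3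
    have e3 : ‖(β - b) * P * (t : ℂ)‖ ≤ 11 / 2 * a * 4 * t := by
      have p1 : ‖β - b‖ * ‖P‖ ≤ 11 / 2 * a * 4 :=
        mul_le_mul hβb5 hPn (norm_nonneg _) (mul_nonneg (by norm_num) ha_nn)
      calc ‖(β - b) * P * (t : ℂ)‖ = ‖β - b‖ * ‖P‖ * t := by
            rw [norm_mul, norm_mul, Complex.norm_real, Real.norm_eq_abs, abs_of_nonneg ht0]
        _ ≤ 11 / 2 * a * 4 * t := mul_le_mul_of_nonneg_right p1 ht0
    have hnum : ‖z₁' * (β - b) * z₂⁻¹ * X - (β - b) * z₂' * z₂⁻¹ * P - (β - b) * P * (t : ℂ)‖ ≤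
        a * (100 * K + 22 * t) := by
      calc _ ≤ ‖z₁' * (β - b) * z₂⁻¹ * X - (β - b) * z₂' * z₂⁻¹ * P‖ + ‖(β - b) * P * (t : ℂ)‖ :=
            norm_sub_le _ _
        _ ≤ (‖z₁' * (β - b) * z₂⁻¹ * X‖ + ‖(β - b) * z₂' * z₂⁻¹ * P‖) + ‖(β - b) * P * (t : ℂ)‖ :=
            add_le_add (norm_sub_le _ _) le_rfl
        _ ≤ (K * (11 / 2 * a) * (16 / 5) + 11 / 2 * a * K * (16 / 5) * 4) + 11 / 2 * a * 4 * t :=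
            add_le_add (add_le_add e1 e2) e3
        _ = a * (88 * K + 22 * t) := by ring
        _ ≤ a * (100 * K + 22 * t) :=
            mul_le_mul_of_nonneg_left
              (add_le_add (mul_le_mul_of_nonneg_right (by norm_num) hK) le_rfl) ha_nn
    calc _ ≤ a * (100 * K + 22 * t) * (3 / 2 * L) :=
          mul_le_mul_of_nonneg_right hnum (mul_nonneg (by norm_num) hL0.le)
      _ = (100 * K + 22 * t) * (3 / 2 * a * L) := by ring
  -- (iv) `‖T₁ − T₀‖ ≤ 15|c′|·aℓ`
  have hT₁T₀n : ‖E * A - appBResBeta b₀ β Lc‖ ≤ 15 * |c'| * (a * ℓ) := by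
    rw [hT₁T₀, norm_mul, norm_mul, hEn, mul_one, hbb₀]
    have hcoef : ‖-1 / β + 1 / (Lc * β ^ 2)‖ ≤ 1 / a := by
      calc ‖-1 / β + 1 / (Lc * β ^ 2)‖ ≤ ‖-1 / β‖ + ‖1 / (Lc * β ^ 2)‖ := norm_add_le _ _
        _ = (3 / 2 * a)⁻¹ + (L * (3 / 2 * a) ^ 2)⁻¹ := by
            rw [norm_div, norm_neg, norm_one, norm_div, norm_one, norm_mul, norm_pow, hLcn, hn6,
              one_div, one_div]
        _ ≤ 1 / a := by
            rw [show L * (3 / 2 * a) ^ 2 = 9 / 4 * (a * L) * a by ring, haL]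
            rw [show (3 / 2 * a)⁻¹ = (2 / 3) / a by field_simp,
              show (9 / 4 * (0.498 * π) * a)⁻¹ = (4 / (9 * 0.498 * π)) / a by field_simp,
              ← add_div, div_le_div_iff_of_pos_right hα0]
            exact hnumC
    have q1 : (j : ℝ) * a * |e| ≤ 3 * a * (5 * |c'| * (a * ℓ)) := by
      have hja : (j : ℝ) * a ≤ 3 * a := mul_le_mul_of_nonneg_right hj3 ha_nn
      exact mul_le_mul hja habs_e (abs_nonneg _) (mul_nonneg (by norm_num) ha_nn)
    have q2 : (j : ℝ) * a * |e| * ‖-1 / β + 1 / (Lc * β ^ 2)‖ ≤ 3 * a * (5 * |c'| * (a * ℓ)) * (1 / a) :=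
      mul_le_mul q1 hcoef (norm_nonneg _)
        (mul_nonneg (mul_nonneg (by norm_num) ha_nn) (mul_nonneg (mul_nonneg (by norm_num) (abs_nonneg _))
          (mul_nonneg ha_nn hℓ0.le)))
    calc _ ≤ 3 * a * (5 * |c'| * (a * ℓ)) * (1 / a) := q2
      _ = 15 * |c'| * (a * ℓ) := by field_simp; ring
  -- assemble: `V − T₀ = ((P − E)A + R) + (T₁ − T₀)`
  have hsplit : -(z₁ * (β - b) * z₂⁻¹ * X / Lc / β ^ 2) +
      (((z₁' * (β - b) + z₁ * 1) * z₂⁻¹ + z₁ * (β - b) * (-z₂' / z₂ ^ 2)) * X +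
          z₁ * (β - b) * z₂⁻¹ * (X * ((L - t : ℝ) : ℂ))) / Lc / β - T₀ =
        ((P - E) * A + R) + (E * A - appBResBeta b₀ β Lc) := by
    rw [← key, hT₀eq]; ring
  rw [hsplit]
  -- the final numerics, everything in units of `α₁`
  have hL' : 3 / 2 * L = 0.747 * ℓ ^ 9 := by rw [hLeq]; ring
  have hRα : (100 * K + 22 * t) / (3 / 2 * L) ≤ (45 * K + 10) * alpha1 D := by
    rw [hL', div_le_iff₀ (mul_pos (by norm_num) (pow_pos hℓ0 9))]
    have hα1ℓ9 : alpha1 D * ℓ ^ 9 = π * ℓ ^ (1.1 : ℝ) := by rw [hα1, ← h9]; ring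
    calc 100 * K + 22 * t ≤ 100 * (K * ℓ ^ (1.1 : ℝ)) + 22 * ℓ ^ (1.1 : ℝ) :=
          add_le_add (mul_le_mul_of_nonneg_left (le_mul_of_one_le_right hK h11) (by norm_num))
            (mul_le_mul_of_nonneg_left htT (by norm_num))
      _ ≤ (45 * K + 10) * (0.747 * (π * ℓ ^ (1.1 : ℝ))) := hnumR
      _ = (45 * K + 10) * alpha1 D * (0.747 * ℓ ^ 9) := by rw [← hα1ℓ9]; ring
  have s1 : ‖(P - E) * A + R‖ ≤ ‖P - E‖ * ‖A‖ + ‖R‖ :=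
    (norm_add_le _ _).trans (by rw [norm_mul])
  have s2 : ‖P - E‖ * ‖A‖ ≤ (24 * (K * a) + 3 / 2 * a * t) * 5 :=
    mul_le_mul hPE hA5 hA_nn
      (add_nonneg (mul_nonneg (by norm_num) hKa_nn) (mul_nonneg (mul_nonneg (by norm_num) ha_nn) ht0))
  have e1 : K * a ≤ K * alpha1 D := mul_le_mul_of_nonneg_left haα1 hK
  have e2 : |c'| * (a * ℓ) ≤ |c'| * alpha1 D := mul_le_mul_of_nonneg_left haℓα1 (abs_nonneg c')
  have e5 : 3 / 2 * a * t ≤ 3 / 2 * alpha1 D := by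
    rw [mul_assoc]; exact mul_le_mul_of_nonneg_left hatα1 (by norm_num)
  have e6 : (24 * (K * a) + 3 / 2 * a * t) * 5 ≤ (24 * (K * alpha1 D) + 3 / 2 * alpha1 D) * 5 :=
    mul_le_mul_of_nonneg_right (add_le_add (mul_le_mul_of_nonneg_left e1 (by norm_num)) e5)
      (by norm_num)
  have e7 : 15 * |c'| * (a * ℓ) ≤ 15 * |c'| * alpha1 D := by
    rw [mul_assoc, mul_assoc]; exact mul_le_mul_of_nonneg_left e2 (by norm_num)
  calc ‖(P - E) * A + R + (E * A - appBResBeta b₀ β Lc)‖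
      ≤ ‖(P - E) * A + R‖ + ‖E * A - appBResBeta b₀ β Lc‖ := norm_add_le _ _
    _ ≤ (‖P - E‖ * ‖A‖ + ‖R‖) + ‖E * A - appBResBeta b₀ β Lc‖ := add_le_add s1 le_rfl
    _ ≤ ((24 * (K * a) + 3 / 2 * a * t) * 5 + (100 * K + 22 * t) / (3 / 2 * L)) +
        15 * |c'| * (a * ℓ) := add_le_add (add_le_add s2 hRn) hT₁T₀n
    _ ≤ ((24 * (K * alpha1 D) + 3 / 2 * alpha1 D) * 5 + (45 * K + 10) * alpha1 D) +
        15 * |c'| * alpha1 D := add_le_add (add_le_add e6 hRα) e7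
    _ = (165 * K + 35 / 2 + 15 * |c'|) * alpha1 D := by ring
    _ ≤ (200 * K + 40 + 15 * |c'|) * alpha1 D :=
        mul_le_mul_of_nonneg_right
          (add_le_add (add_le_add (mul_le_mul_of_nonneg_right (by norm_num) hK)
            (by norm_num)) le_rfl) hα1nn

/-- **`Typed.AppendixB.StepB_mu3R c′` from the two remaining `μ = 3` inputs** (App. B p. 107, "In case
`μ = 3` the proof can be obtained with `β₆` and `P₃` in place of `β₇` and `P₂`"; reading `α₁ = α log T`):
GIVEN the `μ = 3` Perron identity `Σ_l ϰ₃(l₁l)ϱ_j(l)/l = (1/2πi)∫_{(1)} ζ(1+s)/ζ(1+s−β_j)·(P₃/l₁)ˢ/((log P₃)(s−β₆)²)ds`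
(twin of `StepB_u009`) and the `μ = 3` line-to-circle bound at rate `α₁` (twin of `StepB_u009rR`), the
conclusion follows — the split, the residue at `0` (`…Mu3Circles`) and the value of the `β₆`-residue
(`circleIntegral_intB3_beta6_sub_main_le`) being THEOREMS. [cite: Zhang2022LandauSiegel, App. B p.107] -/
theorem stepB_mu3R_of_perron_shift
    (h9 : ForAllLarge fun D _ _ => ∀ j ∈ ({1, 2, 3} : Finset ℕ), ∀ l₁ : ℕ, 1 ≤ l₁ →
      vkSum c' D (vk3 D) j l₁ = vline 1 (fun s => zetaRatio c' D j s * kerB (P3 D) (beta6 D) l₁ s))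
    (h9r : ∃ C : ℝ, ForAllLarge fun D _ _ => ∀ j ∈ ({1, 2, 3} : Finset ℕ), ∀ l₁ : ℕ, 1 ≤ l₁ →
      l₁ ∈ nset (frakq D) → (l₁ : ℝ) < bigT D →
        ‖vline 1 (fun s => zetaRatio c' D j s * kerB (P3 D) (beta6 D) l₁ s) -
            (2 * π * I)⁻¹ * (∮ s in C((0 : ℂ), 5 * alpha D),
              zetaRatio c' D j s * kerB (P3 D) (beta6 D) l₁ s)‖ ≤ C * alpha1 D) :
    Typed.AppendixB.StepB_mu3R c' :=
  stepB_mu3R_of c' h9 h9r (circleIntegral_intB3_beta6_sub_main_le c')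

end Value

end Literature.NumberTheory.LFunctions.Zhang2022.Skeleton
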